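import Literature.NumberTheory.EllipticCurves.EichlerBasisTheoremOfTraceIdentity
import Literature.NumberTheory.Automorphic.HeckeTraceFormulaGL2LevelPrimeDifference
import HarnessLib

/-!
# Eichler's basis theorem and multiplicity one for Brandt eigen-lattices from the two trace
# formulas (Eichler–Selberg at the levels `Mp`, `M`, and Eichler's trace formula for Brandt
# matrices)

[Proofs] Theorems only (D-0026). `EichlerBasisTheoremOfTraceIdentity.lean` proves Pizer's
Thm. 2.28 (`BrandtJL.nonempty_eichlerPizerIso_of_traceIdentity`) and the named fact
`takahashi2001_brandtEigenLattice_rank_one` (`…_of_traceIdentity`) from Eichler's TRACE IDENTITY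
(A. Pizer, J. Algebra 64 (1980), Thm. 2.25 (2.8), `r = 0`, `k = 2`; Eichler 1955 (5)):

  `tr_{S₂(Γ₀(Mp))} T(n) = tr B(n; p, M) - σ₁(n) + 2 tr_{S₂(Γ₀(M))} T(n)`,  `(n, Mp) = 1`,

whose printed proof is "by having explicit formulas for the traces of the Hecke operators and the
trace of the Brandt matrix" (loc. cit. p. 359). This file performs that comparison as far as the
tree's vocabulary allows: the `GL₂` half — the Eichler–Selberg trace formula at the levels `Mp`
and `M`, i.e. the named fact `HeckeTraceFormulaGL2Level N 𝟙 2` (Schoof–van der Vlugt Thm. 2.2,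
Cohen–Oesterlé's form) — is reduced in `HeckeTraceFormulaGL2LevelPrimeDifference.lean` to

  `tr_{Mp} T(n) - 2 tr_M T(n) = δ(n = □)(p - 1)ψ(M)/12 - σ₁(n)
      - ½ Σ_{t² < 4n} Σ_f h_w((t² - 4n)/f²) μ_M(t, f, n)(μ_p(t, f, n) - 2)`,

so that (2.8) becomes EQUIVALENT to the following form of **Eichler's trace formula for the
Brandt matrices** `B(n) = Brandt.matrix S.O n` of an Eichler order of level `M` in the definite
quaternion algebra of prime discriminant `p` (hypothesis `hB` below, for `(n, Mp) = 1`):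

  `tr B(n) = δ(n = □)(p - 1)ψ(M)/12 + ½ Σ_{t² < 4n} Σ_f h_w((t² - 4n)/f²) μ_M(t, f, n)(2 - μ_p(t, f, n))`,

with the local densities `μ_N = localDensity N 𝟙` of the Cohen–Oesterlé formula
(`2 - μ_p(t, f, n) = 1 - (d/p)` for `p ∤ f`, `= 1 - p` for `p ∣ f`, `d = t² - 4n`). The mass term
`(p - 1)ψ(M)/12 = Σ_i 1/#O_iˣ · 2`… is Eichler's mass formula (Vignéras V Cor. 2.3, the tree's
`brandtModule_massFormula`), and the elliptic term is Eichler's (Vignéras, LNM 800, Ch. V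
Prop. 2.4: `tr P(A) = M·δ + ½ Σ_{(x,B)} M(B)`, `M(B) = h(B)/w(B) ∏_q m_q(B)` with the local
optimal-embedding numbers `m_q` of III.5.11–5.12) after re-summation over the orders
`B ⊇ ℤ[x]` by the class-number index formula `h_w(D c²) = h_w(D) c ∏_{ℓ ∣ c}(1 - (D/ℓ)/ℓ)`
(Cox, *Primes of the form x² + ny²*, Thm. 7.24) — at the primes `q ∣ M` this turns Eichler's
optimal-embedding counts into the Cohen–Oesterlé densities `μ_q`, at `p` it turns
`(1 - (K/p))·[B_p maximal]` into `2 - μ_p`. Neither Eichler's formula nor the index formula is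
in the tree; they enter here only as the hypothesis `hB`, in the tree's vocabulary.

## Main results

* `traceIdentity_of_traceFormulas` — (2.8) for a Brandt setup `S` of type `(M, p)` from
  `HeckeTraceFormulaGL2Level (M p) 𝟙 2`, `HeckeTraceFormulaGL2Level M 𝟙 2` and `hB`.
* `BrandtJL.nonempty_eichlerPizerIso_of_traceFormulas` — Pizer's Thm. 2.28 (Eichler's basis
  theorem in Hecke-module form, `(ℂ^{Cls O})⁰ ⊕ S₂(M)² ≅ S₂(Mp)`) from the same.
* `takahashi2001_brandtEigenLattice_rank_one_of_traceFormulas` — the named fact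
  `takahashi2001_brandtEigenLattice_rank_one` from the Eichler–Selberg trace formula in weight `2`,
  trivial character, all levels, and Eichler's trace formula for Brandt matrices in the above form.

## References

* [Pizer1980] A. Pizer, J. Algebra 64 (1980) 340–390: Thm. 2.25 (2.8), Remark 2.26, Thm. 2.28.
* [SchoofVandervlugt1991] R. Schoof, M. van der Vlugt, JCTA 57 (1991), Thm. 2.2, p. 168.
* [VignerasLNM800] M.-F. Vignéras, *Arithmétique des algèbres de quaternions*, LNM 800 (1980),
  Ch. III Thm. 5.11, Ch. V Prop. 2.4, Cor. 2.3, Cor. 2.5.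
* M. Eichler, J. reine angew. Math. 195 (1955) 127–151, (5); D. A. Cox, *Primes of the form
  x² + ny²*, Thm. 7.24.
-/

noncomputable section

open scoped ArithmeticFunction.sigma
open ArithmeticFunction

namespace Literature.NumberTheory.EllipticCurves

open Literature.NumberTheory.Automorphic Literature.NumberTheory.Automorphic.HeckeTraceFormulaGL2Level
open Brandt

/-- **Eichler's trace identity (Pizer 1980 Thm. 2.25 (2.8), `r = 0`, `k = 2`) from the two trace
formulas:** for `p` prime, `p ∤ M`, a Brandt setup `S` of type `(M, p)`, the Eichler–Selberg
trace formula at the levels `Mp` and `M` (weight `2`, trivial character) and Eichler's trace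
formula for the Brandt matrices of `S` in Cohen–Oesterlé organisation (`hB`), one has
`tr_{Mp} T(n) = tr B(n) - σ₁(n) + 2 tr_M T(n)` for all `n ≥ 1` prime to `Mp`.
[cite: Pizer1980, Thm. 2.25 (2.8) and its proof, p. 359] -/
theorem traceIdentity_of_traceFormulas {M p : ℕ} [NeZero M] [NeZero (M * p)] (hp : p.Prime)
    (hpM : ¬ p ∣ M) (S : XiSetup M p) [Fintype (ClassSet S.O)]
    (hTF₁ : HeckeTraceFormulaGL2Level (M * p) 1 2) (hTF₂ : HeckeTraceFormulaGL2Level M 1 2)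
    (hB : ∀ n : ℕ, 0 < n → n.Coprime (M * p) →
      (((Brandt.matrix S.O n).trace : ℤ) : ℂ) =
        (if IsSquare n then ((p : ℂ) - 1) * (dedekindPsi M : ℂ) / 12 else 0) +
          (1 / 2 : ℂ) *
            ∑ t ∈ (Finset.Icc (-(2 * n : ℤ)) (2 * n)).filter (fun t : ℤ => t ^ 2 < 4 * (n : ℤ)),
              ∑ f ∈ ellipticConductors t n,
                (weightedClassNumber ((t ^ 2 - 4 * n) / (f : ℤ) ^ 2) : ℂ) *
                  (localDensity M 1 t f n * (2 - localDensity p 1 t f n))) :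
    ∀ n : ℕ, 0 < n → n.Coprime (M * p) →
      cuspidalHeckeTrace (M * p) 2 1 n =
        (((Brandt.matrix S.O n).trace : ℤ) : ℂ) - ((σ 1 n : ℕ) : ℂ) +
          2 * cuspidalHeckeTrace M 2 1 n := by
  intro n hn0 hn
  have h := cuspidalHeckeTrace_mul_prime_sub_of_traceFormula hp hpM hTF₁ hTF₂ hn0 hn
  have hBn := hB n hn0 hn
  have hneg : (∑ t ∈ (Finset.Icc (-(2 * n : ℤ)) (2 * n)).filter (fun t : ℤ => t ^ 2 < 4 * (n : ℤ)),
      ∑ f ∈ ellipticConductors t n,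
        (weightedClassNumber ((t ^ 2 - 4 * n) / (f : ℤ) ^ 2) : ℂ) *
          (localDensity M 1 t f n * (2 - localDensity p 1 t f n))) =
      -∑ t ∈ (Finset.Icc (-(2 * n : ℤ)) (2 * n)).filter (fun t : ℤ => t ^ 2 < 4 * (n : ℤ)),
        ∑ f ∈ ellipticConductors t n,
          (weightedClassNumber ((t ^ 2 - 4 * n) / (f : ℤ) ^ 2) : ℂ) *
            (localDensity M 1 t f n * (localDensity p 1 t f n - 2)) := by
    rw [← Finset.sum_neg_distrib]
    refine Finset.sum_congr rfl fun t _ ↦ ?_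
    rw [← Finset.sum_neg_distrib]
    refine Finset.sum_congr rfl fun f _ ↦ ?_
    ring
  rw [hneg] at hBn
  linear_combination h - hBn

/-- `r ∤ M` for `M r` square-free and `r` prime. [folklore] -/
theorem not_dvd_of_squarefree_mul {M r : ℕ} (hr : r.Prime) (hsq : Squarefree (M * r)) : ¬ r ∣ M := by
  rintro ⟨c, hc⟩
  have hunit : IsUnit r := hsq r ⟨c, by rw [hc]; ring⟩
  exact hr.one_lt.ne' (Nat.isUnit_iff.mp hunit)

/-- **Pizer's Theorem 2.28 (Eichler's basis theorem in Hecke-module form) from the two trace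
formulas:** `(ℂ^{Cls O})⁰ ⊕ S₂(Γ₀(M))² ≅ S₂(Γ₀(Mr))` Hecke-equivariantly away from `Mr`, for a
Brandt setup of type `(M, r)`, `r` prime, `r ∤ M`. [cite: Pizer1980, Thm. 2.28 and Thm. 2.25 (2.8)] -/
theorem BrandtJL.nonempty_eichlerPizerIso_of_traceFormulas {M r : ℕ} [NeZero M] [NeZero (M * r)]
    (hr : r.Prime) (hrM : ¬ r ∣ M) (S : XiSetup M r) [Fintype (ClassSet S.O)]
    (hTF₁ : HeckeTraceFormulaGL2Level (M * r) 1 2) (hTF₂ : HeckeTraceFormulaGL2Level M 1 2)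
    (hB : ∀ n : ℕ, 0 < n → n.Coprime (M * r) →
      (((Brandt.matrix S.O n).trace : ℤ) : ℂ) =
        (if IsSquare n then ((r : ℂ) - 1) * (dedekindPsi M : ℂ) / 12 else 0) +
          (1 / 2 : ℂ) *
            ∑ t ∈ (Finset.Icc (-(2 * n : ℤ)) (2 * n)).filter (fun t : ℤ => t ^ 2 < 4 * (n : ℤ)),
              ∑ f ∈ ellipticConductors t n,
                (weightedClassNumber ((t ^ 2 - 4 * n) / (f : ℤ) ^ 2) : ℂ) *
                  (localDensity M 1 t f n * (2 - localDensity r 1 t f n))) :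
    Nonempty (BrandtJL.EichlerPizerIso S) :=
  BrandtJL.nonempty_eichlerPizerIso_of_traceIdentity S
    (traceIdentity_of_traceFormulas hr hrM S hTF₁ hTF₂ hB)

/-- **`takahashi2001_brandtEigenLattice_rank_one` from the two trace formulas** — the
Eichler–Selberg trace formula on `S₂(Γ₀(N))` for all `N` (the tree's named fact
`HeckeTraceFormulaGL2Level N 𝟙 2`) and Eichler's trace formula for the Brandt matrices of every
Brandt setup of type `(M, p)`, `p` prime, `p ∤ M`, in Cohen–Oesterlé organisation.
[cite: Pizer1980, Thm. 2.25 (2.8) and Thm. 2.28] [cite: Takahashi2001, §2 p. 78] -/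
theorem takahashi2001_brandtEigenLattice_rank_one_of_traceFormulas
    (hTF : ∀ (N : ℕ) [NeZero N], HeckeTraceFormulaGL2Level N 1 2)
    (hB : ∀ (M p : ℕ) [NeZero M] [NeZero (M * p)], p.Prime → ¬ p ∣ M →
      ∀ (S : XiSetup M p) [Fintype (ClassSet S.O)] (n : ℕ), 0 < n → n.Coprime (M * p) →
        (((Brandt.matrix S.O n).trace : ℤ) : ℂ) =
          (if IsSquare n then ((p : ℂ) - 1) * (dedekindPsi M : ℂ) / 12 else 0) +
            (1 / 2 : ℂ) *
              ∑ t ∈ (Finset.Icc (-(2 * n : ℤ)) (2 * n)).filter (fun t : ℤ => t ^ 2 < 4 * (n : ℤ)),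
                ∑ f ∈ ellipticConductors t n,
                  (weightedClassNumber ((t ^ 2 - 4 * n) / (f : ℤ) ^ 2) : ℂ) *
                    (localDensity M 1 t f n * (2 - localDensity p 1 t f n))) :
    takahashi2001_brandtEigenLattice_rank_one :=
  takahashi2001_brandtEigenLattice_rank_one_of_traceIdentity fun M r _ _ hr hsq S _ =>
    traceIdentity_of_traceFormulas hr (not_dvd_of_squarefree_mul hr hsq) S (hTF _) (hTF _)
      (hB M r hr (not_dvd_of_squarefree_mul hr hsq) S)

end Literature.NumberTheory.EllipticCurves

end
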